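import Mathlib
import Literature.Analysis.Asymptotics.MonomialAmplitudeLaplace
import HarnessLib

/-!
# ζ(5) search — Families: monomial integrals over ordered sectors (Hepp-sector engine)

HONEST FRAMING: systematic search; no irrationality claim unless certified.  This file contains NO statement about
zeta values.  It is the one-dimensional-peeling engine behind the ANALYTIC half of Brown's convergence criterion
for generalised cellular integrals [Brown2016, §2.4, Lemma 3.6, Def. 5.1] (`Families/CellularIntegral.lean` states the
COMBINATORIAL predicate `BrownConvergent`; its identification with integrability is proved in the sequel files
`Families/GapCoordinates`, `Families/SimplexPowerIntegrability`, `Families/IntegrabilityCriterion` of seat P2).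

For `r` real variables ordered increasingly, `0 < x₀ ≤ x₁ ≤ ⋯ ≤ x_{r−1} ≤ cap` (`sectorSet r cap`), and real
exponents `e : Fin r → ℝ`, the monomial integral `∫ ∏_j x_j^{e_j} dx` over the sector is FINITE iff the TAIL CONDITIONS
`−1 < j + Σ_{i ≤ j} e_i` hold for every `j < r` (`TailOK e`; `lintegral_sectorSet_mono_lt_top_iff`).  Proof: peel the
smallest variable `x₀` (Tonelli along `MeasurableEquiv.piFinSuccAbove … 0`): `∫₀^{x₁} x₀^{e₀} dx₀ = x₁^{e₀+1}/(e₀+1)`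
if `e₀ > −1` (then the exponent of `x₁` becomes `e₁ + e₀ + 1`, `shiftExp`), and `= +∞` otherwise; induction on `r`.
This is the classical sector bookkeeping of Hepp/Speer for Feynman-type integrals, specialised to monomials
[folklore; cf. Brown2016 §2.4 for the statement it serves].  Standard axioms only.
-/

noncomputable section

open MeasureTheory Set ENNReal

namespace Summit.KontsevichZagierPeriods.Zeta5Search.Families.Sector

/-- The ordered sector `0 < x₀ ≤ x₁ ≤ ⋯ ≤ x_{r−1} ≤ cap` in `ℝ^r`. -/
def sectorSet (r : ℕ) (cap : ℝ) : Set (Fin r → ℝ) :=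
  {x | (∀ j, 0 < x j) ∧ (∀ j, x j ≤ cap) ∧ ∀ i j : Fin r, i ≤ j → x i ≤ x j}

/-- The monomial `∏_j x_j ^ e_j` (real exponents). -/
def mono {r : ℕ} (e : Fin r → ℝ) (x : Fin r → ℝ) : ℝ := ∏ j, x j ^ e j

/-- Partial sums of the exponents: `Σ_{i ≤ j} e_i`. -/
def psum {r : ℕ} (e : Fin r → ℝ) (j : Fin r) : ℝ := ∑ i, if i ≤ j then e i else 0

/-- The tail conditions `−1 < j + Σ_{i ≤ j} e_i` for every `j`. -/
def TailOK {r : ℕ} (e : Fin r → ℝ) : Prop := ∀ j : Fin r, -1 < (j : ℝ) + psum e j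

/-- The exponents after the smallest variable has been integrated out: `x₁` picks up `e₀ + 1`. -/
def shiftExp {r : ℕ} (e : Fin (r + 1) → ℝ) : Fin r → ℝ :=
  fun j => e j.succ + if (j : ℕ) = 0 then e 0 + 1 else 0

/-- The upper limit of the smallest variable: the next variable `xs 0` if there is one, else `cap`. -/
def lead {r : ℕ} (cap : ℝ) (xs : Fin r → ℝ) : ℝ := if h : 0 < r then xs ⟨0, h⟩ else cap

/-! ### Membership and measurability -/

/-- Peeling the smallest coordinate of the sector. -/
theorem cons_mem_sectorSet_iff {r : ℕ} (cap : ℝ) (x0 : ℝ) (xs : Fin r → ℝ) :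
    (Fin.cons x0 xs : Fin (r + 1) → ℝ) ∈ sectorSet (r + 1) cap ↔
      xs ∈ sectorSet r cap ∧ 0 < x0 ∧ x0 ≤ lead cap xs := by
  constructor
  · rintro ⟨hpos, hcap, hmono⟩
    have hpos' : ∀ j : Fin r, 0 < xs j := fun j => by simpa using hpos j.succ
    have hcap' : ∀ j : Fin r, xs j ≤ cap := fun j => by simpa using hcap j.succ
    have hmono' : ∀ i j : Fin r, i ≤ j → xs i ≤ xs j := fun i j hij => by
      simpa using hmono i.succ j.succ (Fin.succ_le_succ_iff.2 hij)
    refine ⟨⟨hpos', hcap', hmono'⟩, by simpa using hpos 0, ?_⟩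
    unfold lead
    split_ifs with hr
    · have := hmono 0 (Fin.succ ⟨0, hr⟩) (Fin.zero_le _)
      simpa only [Fin.cons_zero, Fin.cons_succ] using this
    · simpa using hcap 0
  · rintro ⟨⟨hpos', hcap', hmono'⟩, h0, hle⟩
    have hle' : ∀ i : Fin r, x0 ≤ xs i := fun i => by
      have hr : 0 < r := by have := i.isLt; omega
      have h1 : x0 ≤ xs ⟨0, hr⟩ := by simpa [lead, hr] using hle
      exact h1.trans (hmono' _ _ (Fin.mk_le_of_le_val (Nat.zero_le _)))
    have hcap0 : x0 ≤ cap := by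
      by_cases hr : 0 < r
      · exact (hle' ⟨0, hr⟩).trans (hcap' _)
      · simpa [lead, hr] using hle
    refine ⟨fun j => ?_, fun j => ?_, fun i j hij => ?_⟩
    · rcases Fin.eq_zero_or_eq_succ j with rfl | ⟨i, rfl⟩
      · simpa using h0
      · simpa using hpos' i
    · rcases Fin.eq_zero_or_eq_succ j with rfl | ⟨i, rfl⟩
      · simpa using hcap0
      · simpa using hcap' i
    · rcases Fin.eq_zero_or_eq_succ i with rfl | ⟨i', rfl⟩
      · rcases Fin.eq_zero_or_eq_succ j with rfl | ⟨j', rfl⟩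
        · simp
        · simpa using hle' j'
      · rcases Fin.eq_zero_or_eq_succ j with rfl | ⟨j', rfl⟩
        · exact absurd hij (by simp [Fin.succ_ne_zero])
        · simpa using hmono' i' j' (Fin.succ_le_succ_iff.1 hij)

/-- The sector is a measurable set. -/
theorem measurableSet_sectorSet (r : ℕ) (cap : ℝ) : MeasurableSet (sectorSet r cap) := by
  have h1 : MeasurableSet {x : Fin r → ℝ | ∀ j, 0 < x j} := by
    have : {x : Fin r → ℝ | ∀ j, 0 < x j} = ⋂ j, {x | 0 < x j} := by ext; simp
    rw [this]; exact MeasurableSet.iInter fun j => measurableSet_lt measurable_const (measurable_pi_apply j)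
  have h2 : MeasurableSet {x : Fin r → ℝ | ∀ j, x j ≤ cap} := by
    have : {x : Fin r → ℝ | ∀ j, x j ≤ cap} = ⋂ j, {x | x j ≤ cap} := by ext; simp
    rw [this]; exact MeasurableSet.iInter fun j => measurableSet_le (measurable_pi_apply j) measurable_const
  have h3 : MeasurableSet {x : Fin r → ℝ | ∀ i j : Fin r, i ≤ j → x i ≤ x j} := by
    have : {x : Fin r → ℝ | ∀ i j : Fin r, i ≤ j → x i ≤ x j} = ⋂ i, ⋂ j, {x | i ≤ j → x i ≤ x j} := by
      ext; simp
    rw [this]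
    refine MeasurableSet.iInter fun i => MeasurableSet.iInter fun j => ?_
    by_cases hij : i ≤ j
    · have : {x : Fin r → ℝ | i ≤ j → x i ≤ x j} = {x | x i ≤ x j} := by ext; simp [hij]
      rw [this]; exact measurableSet_le (measurable_pi_apply i) (measurable_pi_apply j)
    · have : {x : Fin r → ℝ | i ≤ j → x i ≤ x j} = univ := by ext; simp [hij]
      rw [this]; exact MeasurableSet.univ
  have : sectorSet r cap = {x | ∀ j, 0 < x j} ∩ {x | ∀ j, x j ≤ cap} ∩ {x | ∀ i j : Fin r, i ≤ j → x i ≤ x j} := by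
    ext x; simp [sectorSet, and_assoc]
  rw [this]
  exact (h1.inter h2).inter h3

/-- The monomial is measurable. -/
theorem measurable_mono {r : ℕ} (e : Fin r → ℝ) : Measurable (mono e) := by
  unfold mono
  exact Finset.measurable_prod _ fun j _ => (measurable_pi_apply j).pow_const _

/-- The monomial is positive on the positive orthant. -/
theorem mono_pos {r : ℕ} (e : Fin r → ℝ) {x : Fin r → ℝ} (hx : ∀ j, 0 < x j) : 0 < mono e x :=
  Finset.prod_pos fun j _ => Real.rpow_pos_of_pos (hx j) _

/-- The sector has positive volume (it contains a box). -/
theorem volume_sectorSet_ne_zero (r : ℕ) {cap : ℝ} (hcap : 0 < cap) : volume (sectorSet r cap) ≠ 0 := by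
  set B : Set (Fin r → ℝ) :=
    Set.pi univ fun j : Fin r => Ioc (cap * j / (r + 1)) (cap * (j + 1) / (r + 1)) with hB
  have hsub : B ⊆ sectorSet r cap := by
    intro x hx
    simp only [hB, mem_pi, mem_univ, mem_Ioc, forall_true_left] at hx
    have hr : (0 : ℝ) < r + 1 := by positivity
    refine ⟨fun j => ?_, fun j => ?_, fun i j hij => ?_⟩
    · exact lt_of_le_of_lt (by positivity) (hx j).1
    · refine (hx j).2.trans ?_
      rw [div_le_iff₀ hr]
      have : ((j : ℕ) : ℝ) + 1 ≤ r + 1 := by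
        have := j.isLt; exact_mod_cast (by omega : (j : ℕ) + 1 ≤ r + 1)
      nlinarith
    · rcases hij.lt_or_eq with hlt | heq
      · refine (hx i).2.trans (le_trans ?_ (hx j).1.le)
        have : ((i : ℕ) : ℝ) + 1 ≤ (j : ℕ) := by exact_mod_cast Nat.succ_le_of_lt (Fin.lt_def.1 hlt)
        exact div_le_div_of_nonneg_right (by nlinarith) hr.le
      · rw [heq]
  have hvol : volume B = ∏ j : Fin r, ENNReal.ofReal (cap * ((j : ℕ) + 1) / (r + 1) - cap * j / (r + 1)) := by
    rw [hB, volume_pi_pi]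
    simp only [Real.volume_Ioc]
  have hpos : volume B ≠ 0 := by
    rw [hvol]
    refine Finset.prod_ne_zero_iff.2 fun j _ => ?_
    rw [Ne, ENNReal.ofReal_eq_zero, not_le]
    have hr : (0 : ℝ) < r + 1 := by positivity
    have : cap * ((j : ℕ) + 1) / (r + 1) - cap * j / (r + 1) = cap / (r + 1) := by field_simp; ring
    rw [this]; positivity
  exact fun h => hpos (measure_mono_null hsub h)

/-! ### One-dimensional integrals -/

/-- `∫_{(0,b]} x^e dx = b^{e+1}/(e+1)` for `e > −1`. -/
theorem lintegral_Ioc_rpow_of_gt {b e : ℝ} (hb : 0 < b) (he : -1 < e) :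
    ∫⁻ x in Ioc 0 b, ENNReal.ofReal (x ^ e) = ENNReal.ofReal (b ^ (e + 1) / (e + 1)) := by
  have h := Literature.Analysis.Asymptotics.MonomialPhase.lintegral_rpow_Ioc (ω := e + 1) (by linarith) hb
  simp only [add_sub_cancel_right] at h
  exact h

/-- `∫_{(0,b]} x^e dx = +∞` for `e ≤ −1`. -/
theorem lintegral_Ioc_rpow_eq_top {b e : ℝ} (hb : 0 < b) (he : e ≤ -1) :
    ∫⁻ x in Ioc 0 b, ENNReal.ofReal (x ^ e) = ⊤ := by
  by_contra hne
  have hlt : (∫⁻ x in Ioc 0 b, ENNReal.ofReal (x ^ e)) < ⊤ := lt_top_iff_ne_top.2 hne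
  have hnn : 0 ≤ᵐ[volume.restrict (Ioc (0 : ℝ) b)] fun x : ℝ => x ^ e :=
    (ae_restrict_iff' measurableSet_Ioc).2 (ae_of_all _ fun x hx => Real.rpow_nonneg hx.1.le _)
  have hfi : HasFiniteIntegral (fun x : ℝ => x ^ e) (volume.restrict (Ioc 0 b)) :=
    (hasFiniteIntegral_iff_ofReal hnn).2 hlt
  have hint : IntegrableOn (fun x : ℝ => x ^ e) (Ioc 0 b) :=
    ⟨(measurable_id.pow_const e).aestronglyMeasurable, hfi⟩
  have hint' : IntegrableOn (fun x : ℝ => x ^ e) (Ioo 0 b) := hint.mono_set Ioo_subset_Ioc_self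
  have := (intervalIntegral.integrableOn_Ioo_rpow_iff hb).1 hint'
  linarith

/-! ### Exponent bookkeeping -/

/-- `psum e 0 = e 0`. -/
theorem psum_zero {r : ℕ} (e : Fin (r + 1) → ℝ) : psum e 0 = e 0 := by
  unfold psum
  rw [Fin.sum_univ_succ]
  simp

/-- `psum (shiftExp e) j = psum e j.succ + 1`. -/
theorem psum_shiftExp {r : ℕ} (e : Fin (r + 1) → ℝ) (j : Fin r) :
    psum (shiftExp e) j = psum e j.succ + 1 := by
  have hr : 0 < r := by have := j.isLt; omega
  set i0 : Fin r := ⟨0, hr⟩ with hi0def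
  have hi0 : ∀ i : Fin r, ((i : ℕ) = 0) ↔ i = i0 := fun i => by simp [hi0def, Fin.ext_iff]
  have hi0j : i0 ≤ j := Fin.mk_le_of_le_val (Nat.zero_le _)
  unfold psum shiftExp
  simp_rw [hi0]
  rw [Fin.sum_univ_succ]
  simp only [Fin.zero_le, if_true, Fin.succ_le_succ_iff]
  have hsplit : ∀ i : Fin r, (if i ≤ j then e i.succ + (if i = i0 then e 0 + 1 else 0) else 0) =
      (if i ≤ j then e i.succ else 0) + (if i = i0 then e 0 + 1 else 0) := by
    intro i
    by_cases h1 : i ≤ j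
    · simp [h1]
    · have : i ≠ i0 := fun h => h1 (h ▸ hi0j)
      simp [h1, this]
  simp_rw [hsplit, Finset.sum_add_distrib, Finset.sum_ite_eq', Finset.mem_univ, if_true]
  ring

/-- The tail conditions peel: `TailOK e ↔ −1 < e 0 ∧ TailOK (shiftExp e)`. -/
theorem tailOK_succ_iff {r : ℕ} (e : Fin (r + 1) → ℝ) : TailOK e ↔ -1 < e 0 ∧ TailOK (shiftExp e) := by
  unfold TailOK
  rw [Fin.forall_fin_succ, psum_zero]
  simp only [Fin.val_zero, CharP.cast_eq_zero, zero_add, Fin.val_succ, Nat.cast_add, Nat.cast_one,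
    psum_shiftExp]
  constructor
  · rintro ⟨h0, hs⟩
    exact ⟨h0, fun j => by have := hs j; linarith⟩
  · rintro ⟨h0, hs⟩
    exact ⟨h0, fun j => by have := hs j; linarith⟩

/-- On the positive orthant, `mono (shiftExp e) xs = xs 0 ^ (e 0 + 1) * mono (e ∘ succ) xs`. -/
theorem mono_shiftExp {r : ℕ} (hr : 0 < r) (e : Fin (r + 1) → ℝ) {xs : Fin r → ℝ} (hx : ∀ j, 0 < xs j) :
    mono (shiftExp e) xs = xs ⟨0, hr⟩ ^ (e 0 + 1) * mono (fun j => e j.succ) xs := by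
  set i0 : Fin r := ⟨0, hr⟩ with hi0def
  have hi0 : ∀ i : Fin r, ((i : ℕ) = 0) ↔ i = i0 := fun i => by simp [hi0def, Fin.ext_iff]
  unfold mono shiftExp
  simp_rw [hi0]
  have hsplit : ∀ j : Fin r, xs j ^ (e j.succ + if j = i0 then e 0 + 1 else 0) =
      xs j ^ e j.succ * (if j = i0 then xs j ^ (e 0 + 1) else 1) := by
    intro j
    by_cases hj : j = i0
    · rw [if_pos hj, if_pos hj, Real.rpow_add (hx j)]
    · rw [if_neg hj, if_neg hj, add_zero, mul_one]
  simp_rw [hsplit, Finset.prod_mul_distrib, Finset.prod_ite_eq', Finset.mem_univ, if_true]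
  ring

/-- Peeling the smallest variable in the monomial: `mono e (cons x0 xs) = x0 ^ e 0 * mono (e ∘ succ) xs`. -/
theorem mono_cons {r : ℕ} (e : Fin (r + 1) → ℝ) (x0 : ℝ) (xs : Fin r → ℝ) :
    mono e (Fin.cons x0 xs) = x0 ^ e 0 * mono (fun j => e j.succ) xs := by
  unfold mono
  rw [Fin.prod_univ_succ]
  simp

/-! ### The Tonelli step -/

/-- The integrand transported to `ℝ × ℝ^r` along `x = cons x0 xs` splits as a product of indicators. -/
theorem indicator_cons_eq {r : ℕ} (cap : ℝ) (e : Fin (r + 1) → ℝ) (x0 : ℝ) (xs : Fin r → ℝ) :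
    (sectorSet (r + 1) cap).indicator (fun x => ENNReal.ofReal (mono e x)) (Fin.cons x0 xs) =
      (sectorSet r cap).indicator
        (fun xs => (Ioc 0 (lead cap xs)).indicator (fun x0 : ℝ => ENNReal.ofReal (x0 ^ e 0)) x0 *
          ENNReal.ofReal (mono (fun j => e j.succ) xs)) xs := by
  by_cases h : (Fin.cons x0 xs : Fin (r + 1) → ℝ) ∈ sectorSet (r + 1) cap
  · have h' := (cons_mem_sectorSet_iff cap x0 xs).1 h
    rw [indicator_of_mem h, indicator_of_mem h'.1, indicator_of_mem (show x0 ∈ Ioc 0 (lead cap xs) from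
      ⟨h'.2.1, h'.2.2⟩), mono_cons, ENNReal.ofReal_mul (Real.rpow_nonneg h'.2.1.le _)]
  · rw [indicator_of_notMem h]
    by_cases hs : xs ∈ sectorSet r cap
    · rw [indicator_of_mem hs]
      have hx0 : x0 ∉ Ioc 0 (lead cap xs) := by
        intro hx0
        exact h ((cons_mem_sectorSet_iff cap x0 xs).2 ⟨hs, hx0.1, hx0.2⟩)
      rw [indicator_of_notMem hx0, zero_mul]
    · rw [indicator_of_notMem hs]

/-- Tonelli along the smallest variable:
`∫_{sector_{r+1}} ∏ x^e = ∫_{xs ∈ sector_r} (∫_{0}^{lead xs} x0^{e 0} dx0) · ∏_j xs_j^{e_{j+1}} dxs`. -/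
theorem lintegral_sectorSet_succ (r : ℕ) (cap : ℝ) (e : Fin (r + 1) → ℝ) :
    ∫⁻ x in sectorSet (r + 1) cap, ENNReal.ofReal (mono e x) =
      ∫⁻ xs in sectorSet r cap, (∫⁻ x0 in Ioc 0 (lead cap xs), ENNReal.ofReal (x0 ^ e 0)) *
        ENNReal.ofReal (mono (fun j => e j.succ) xs) := by
  set G : (Fin (r + 1) → ℝ) → ℝ≥0∞ := (sectorSet (r + 1) cap).indicator fun x => ENNReal.ofReal (mono e x)
    with hG
  have hGm : Measurable G :=
    (ENNReal.measurable_ofReal.comp (measurable_mono e)).indicator (measurableSet_sectorSet _ _)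
  have hmp := (volume_preserving_piFinSuccAbove (fun _ : Fin (r + 1) => ℝ) 0).symm
  rw [← lintegral_indicator (measurableSet_sectorSet _ _), ← hG,
    ← hmp.lintegral_comp_emb (MeasurableEquiv.measurableEmbedding _)]
  have hcons : ∀ p : ℝ × (Fin r → ℝ),
      (MeasurableEquiv.piFinSuccAbove (fun _ : Fin (r + 1) => ℝ) 0).symm p = Fin.cons p.1 p.2 := by
    intro p
    rw [MeasurableEquiv.piFinSuccAbove_symm_apply, Fin.insertNthEquiv, Equiv.coe_fn_mk, Fin.insertNth_zero']
  simp_rw [hcons]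
  have hGm' : Measurable fun p : ℝ × (Fin r → ℝ) => G (Fin.cons p.1 p.2) := by
    have : (fun p : ℝ × (Fin r → ℝ) => G (Fin.cons p.1 p.2)) =
        G ∘ (MeasurableEquiv.piFinSuccAbove (fun _ : Fin (r + 1) => ℝ) 0).symm := by
      ext p; rw [Function.comp_apply, hcons]
    rw [this]; exact hGm.comp (MeasurableEquiv.measurable _)
  rw [Measure.volume_eq_prod, lintegral_prod_symm' _ hGm']
  rw [← lintegral_indicator (measurableSet_sectorSet _ _)]
  congr 1 with xs
  simp_rw [hG, indicator_cons_eq]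
  by_cases hs : xs ∈ sectorSet r cap
  · simp_rw [indicator_of_mem hs]
    rw [lintegral_mul_const _ (by
      exact ((measurable_id.pow_const _).ennreal_ofReal).indicator measurableSet_Ioc),
      lintegral_indicator measurableSet_Ioc]
  · simp_rw [indicator_of_notMem hs]
    simp

/-! ### Finiteness criterion -/

/-- **Sector monomial integrals**: for `cap > 0`, `∫_{0 < x₀ ≤ ⋯ ≤ x_{r−1} ≤ cap} ∏ x_j^{e_j} dx < ∞` iff the tail
conditions `−1 < j + Σ_{i≤j} e_i` hold for all `j`. [folklore (Hepp sectors); serves Brown2016 Lemma 3.6] -/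
theorem lintegral_sectorSet_mono_lt_top_iff (r : ℕ) {cap : ℝ} (hcap : 0 < cap) (e : Fin r → ℝ) :
    (∫⁻ x in sectorSet r cap, ENNReal.ofReal (mono e x)) < ⊤ ↔ TailOK e := by
  induction r with
  | zero =>
    have hvac : TailOK e := fun j => Fin.elim0 j
    simp only [hvac, iff_true]
    have hset : sectorSet 0 cap = univ := by
      ext x; simp [sectorSet]
    have hm : ∀ x : Fin 0 → ℝ, mono e x = 1 := fun x => by simp [mono]
    simp_rw [hset, Measure.restrict_univ, hm]
    rw [lintegral_const]
    simp
  | succ r ih =>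
    rw [lintegral_sectorSet_succ, tailOK_succ_iff]
    by_cases he : -1 < e 0
    · simp only [he, true_and]
      by_cases hr : 0 < r
      · -- substitute the explicit inner integral and use the induction hypothesis
        have he1 : 0 < e 0 + 1 := by linarith
        have hcongr : ∫⁻ xs in sectorSet r cap, (∫⁻ x0 in Ioc 0 (lead cap xs), ENNReal.ofReal (x0 ^ e 0)) *
              ENNReal.ofReal (mono (fun j => e j.succ) xs) =
            ∫⁻ xs in sectorSet r cap, ENNReal.ofReal (1 / (e 0 + 1)) * ENNReal.ofReal (mono (shiftExp e) xs) := by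
          refine setLIntegral_congr_fun (measurableSet_sectorSet _ _) fun xs hxs => ?_
          have hlead : lead cap xs = xs ⟨0, hr⟩ := by simp [lead, hr]
          have hl : 0 < lead cap xs := by rw [hlead]; exact hxs.1 _
          have hm : 0 ≤ mono (fun j => e j.succ) xs := (mono_pos _ hxs.1).le
          rw [lintegral_Ioc_rpow_of_gt hl he, mono_shiftExp hr e hxs.1, ← hlead,
            ← ENNReal.ofReal_mul (div_nonneg (Real.rpow_nonneg hl.le _) he1.le),
            ← ENNReal.ofReal_mul (by positivity)]
          congr 1; ring
        rw [hcongr, lintegral_const_mul _ ((measurable_mono _).ennreal_ofReal), ← ih (shiftExp e)]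
        have hc : ENNReal.ofReal (1 / (e 0 + 1)) ≠ 0 := by
          rw [Ne, ENNReal.ofReal_eq_zero, not_le]; positivity
        constructor
        · intro h
          rcases ENNReal.mul_lt_top_iff.1 h with h2 | h2 | h2
          · exact h2.2
          · exact absurd h2 hc
          · rw [h2]; exact ENNReal.zero_lt_top
        · intro h
          exact ENNReal.mul_lt_top ENNReal.ofReal_lt_top h
      · -- r = 0: the outer integral is over a point
        have hr0 : r = 0 := by omega
        subst hr0
        have hvac : TailOK (shiftExp e) := fun j => Fin.elim0 j
        simp only [hvac, iff_true]
        have hset : sectorSet 0 cap = univ := by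
          ext x; simp [sectorSet]
        have hm : ∀ x : Fin 0 → ℝ, mono (fun j : Fin 0 => e j.succ) x = 1 := fun x => by simp [mono]
        have hl : ∀ xs : Fin 0 → ℝ, lead cap xs = cap := fun xs => by simp [lead]
        simp_rw [hset, Measure.restrict_univ, hm, hl, lintegral_Ioc_rpow_of_gt hcap he]
        rw [lintegral_const]
        simp [ENNReal.mul_lt_top_iff]
    · simp only [he, false_and, iff_false, not_lt]
      have hcongr : ∫⁻ xs in sectorSet r cap, (∫⁻ x0 in Ioc 0 (lead cap xs), ENNReal.ofReal (x0 ^ e 0)) *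
            ENNReal.ofReal (mono (fun j => e j.succ) xs) = ∫⁻ xs in sectorSet r cap, ⊤ := by
        refine setLIntegral_congr_fun (measurableSet_sectorSet _ _) fun xs hxs => ?_
        have hl : 0 < lead cap xs := by
          unfold lead; split_ifs with h
          · exact hxs.1 _
          · exact hcap
        rw [lintegral_Ioc_rpow_eq_top hl (not_lt.1 he), ENNReal.top_mul]
        rw [Ne, ENNReal.ofReal_eq_zero, not_le]
        exact mono_pos _ hxs.1
      rw [hcongr, setLIntegral_const, ENNReal.top_mul (volume_sectorSet_ne_zero r hcap)]

end Summit.KontsevichZagierPeriods.Zeta5Search.Families.Sector
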